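import Mathlib

/-!
# S1 planar-field definitions (D1 of the S1a skeleton cut, crux `CyclicQuotientFourfolds`)

Crux stmt-ResolutionOfSingularities-17941 (`WildQuotients.CyclicQuotientFourfolds`), S1a skeleton line
`s1a-logminvertex` (plan-1 `S1A-CUT.md` v1.1; director RULING w45c-S1a-RESIDUAL; D1 WIDE form of record,
plan-1 RULING 17:38:33Z, BASE = tri-2 probe adopted 17:46:44Z, reviewer of record idea-1).
DEFINITION LANE ONLY — no theorems. [OURS · L1 W4.5c] — NOT statements of the manuscript; counted 0 post-V5.

A planar formal vector field over a field `κ` is the pair `θ = (θ x, θ y) = (a, b)` of its components in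
`κ[[x, y]] = MvPowerSeries (Fin 2) κ` (`X 0 = x`, `X 1 = y`).  The definitions record: the Milnor number
`μ = dim_κ κ[[x,y]]/(a,b)` and isolatedness, the order `ν`, the linear part, the BAD-node predicate
(singular with nilpotent linear part = order ≥ 2, or order 1 with nilpotent non-zero linear part; the
REDUCED = non-nilpotent singularities are not bad), the SATURATED transform under one point blow-up in the
two charts (division-free `∃`-form, translation `c` re-centring the point `t = c` of the exceptional line),
and the statement `W1NPrint p`: from an isolated bad node every long enough chain of successive transforms
leaves the bad class — Seidenberg's reduction of planar vector-field singularities to reduced ones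
(Seidenberg 1968 in characteristic 0; characteristic-`p` sentence: Brunella 2015 Thm 1 / Posva
arXiv:2405.05735 Rem. 1.0.3), the ONE named external residual of the S1a cut (director condition (1));
AI-level in-house route: tri-2 `W1N-CASCADE.md` §3 T(n) with `N = 2μ + 1` (Noether's formula only),
countersign pending.

* `S1.PlanarField κ` — the pair of components.
* `S1.PlanarField.milnor`, `IsIsolated`, `ord`, `linearPart`, `IsSingular`, `IsBadNode`.
* `S1.PlanarField.chart1 c`, `chart2`, `IsSuccChart1 c`, `IsSuccChart2`, `IsSucc` — the successor relation.
* `S1.W1NPrint p` — the residual statement (stated for every field of characteristic `p`; the consumer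
  applies it over the residue fields of the nodes, badness being invariant under scalar extension).
-/

-- single-problem summit: the doubled namespace component `ResolutionOfSingularities` is forced
set_option linter.dupNamespace false

noncomputable section

open MvPowerSeries

namespace Summit.ResolutionOfSingularities.ResolutionOfSingularities.Theorems.WildQuotientResolution.S1

/-- A planar formal vector field `θ = a ∂ₓ + b ∂_y` over `κ`, recorded by its two components
`a = θ x`, `b = θ y` in `κ[[x,y]] = MvPowerSeries (Fin 2) κ` (`X 0 = x`, `X 1 = y`).
[OURS · L1 W4.5c] — NOT a statement of the manuscript. -/
structure PlanarField (κ : Type) [Field κ] where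
  /-- the component `θ x` -/
  a : MvPowerSeries (Fin 2) κ
  /-- the component `θ y` -/
  b : MvPowerSeries (Fin 2) κ

namespace PlanarField

variable {κ : Type} [Field κ]

/-- Milnor number `μ(θ) = dim_κ κ[[x,y]]/(a,b)` (`Module.finrank`, so `0` when the dimension is
infinite — use together with `IsIsolated`). [OURS · L1 W4.5c] — NOT a statement of the manuscript. -/
def milnor (θ : PlanarField κ) : ℕ :=
  Module.finrank κ (MvPowerSeries (Fin 2) κ ⧸ Ideal.span ({θ.a, θ.b} : Set (MvPowerSeries (Fin 2) κ)))

/-- Isolated zero: the local algebra `κ[[x,y]]/(a,b)` is finite-dimensional over `κ`.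
[OURS · L1 W4.5c] — NOT a statement of the manuscript. -/
def IsIsolated (θ : PlanarField κ) : Prop :=
  Module.Finite κ (MvPowerSeries (Fin 2) κ ⧸ Ideal.span ({θ.a, θ.b} : Set (MvPowerSeries (Fin 2) κ)))

/-- Order `ν(θ) = min (ord a) (ord b)` (in `ℕ∞`; `⊤` only for `θ = 0`).
[OURS · L1 W4.5c] — NOT a statement of the manuscript. -/
def ord (θ : PlanarField κ) : ℕ∞ := min θ.a.order θ.b.order

/-- Linear part `L i j = ∂θ_i/∂x_j (0)`, i.e. the coefficient of `x_j` in the `i`-th component.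
[OURS · L1 W4.5c] — NOT a statement of the manuscript. -/
def linearPart (θ : PlanarField κ) : Matrix (Fin 2) (Fin 2) κ :=
  Matrix.of fun i j => MvPowerSeries.coeff (Finsupp.single j 1) (if i = 0 then θ.a else θ.b)

/-- Singular point at the origin: both components have zero constant term.
[OURS · L1 W4.5c] — NOT a statement of the manuscript. -/
def IsSingular (θ : PlanarField κ) : Prop :=
  MvPowerSeries.constantCoeff θ.a = 0 ∧ MvPowerSeries.constantCoeff θ.b = 0

/-- BAD node (WIDE form of record): singular with NILPOTENT linear part — equivalently order `≥ 2`
(linear part `0`) or order `1` with nilpotent non-zero linear part.  Reduced singularities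
(non-nilpotent linear part) are not bad. [OURS · L1 W4.5c] — NOT a statement of the manuscript. -/
def IsBadNode (θ : PlanarField κ) : Prop := θ.IsSingular ∧ IsNilpotent θ.linearPart

/-- The chart-1 blow-up substitution at the point `t = c` of the exceptional line, re-centred:
`x ↦ x`, `y ↦ x · (y + c)`. [OURS · L1 W4.5c] — NOT a statement of the manuscript. -/
def chart1 (c : κ) : Fin 2 → MvPowerSeries (Fin 2) κ :=
  fun i => if i = 0 then X 0 else X 0 * (X 1 + C c)

/-- The chart-2 blow-up substitution (the point `∞` of the exceptional line): `x ↦ x · y`, `y ↦ y`.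
[OURS · L1 W4.5c] — NOT a statement of the manuscript. -/
def chart2 : Fin 2 → MvPowerSeries (Fin 2) κ :=
  fun i => if i = 0 then X 0 * X 1 else X 1

/-- `θ'` is the SATURATED transform of `θ` in chart 1 at the point `c`: for some `s`,
`x^s · a' = a∘π`, `x^(s+1) · b' = (b − (y + c)·a)∘π`, and `x` does not divide both `a'` and `b'`
(division-free; `s = ν − 1` in the non-dicritical case, `s = ν` in the dicritical case).
[OURS · L1 W4.5c] — NOT a statement of the manuscript. -/
def IsSuccChart1 (c : κ) (θ θ' : PlanarField κ) : Prop :=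
  ∃ s : ℕ, X 0 ^ s * θ'.a = MvPowerSeries.subst (chart1 c) θ.a ∧
    X 0 ^ (s + 1) * θ'.b =
      MvPowerSeries.subst (chart1 c) θ.b - (X 1 + C c) * MvPowerSeries.subst (chart1 c) θ.a ∧
    ¬ (X 0 ∣ θ'.a ∧ X 0 ∣ θ'.b)

/-- `θ'` is the saturated transform of `θ` in chart 2 at the point `∞` (no translation: the other
points of the exceptional line are seen in chart 1): `y^s · b' = b∘π`, `y^(s+1) · a' = (a − x·b)∘π`,
`y` does not divide both. [OURS · L1 W4.5c] — NOT a statement of the manuscript. -/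
def IsSuccChart2 (θ θ' : PlanarField κ) : Prop :=
  ∃ s : ℕ, X 1 ^ s * θ'.b = MvPowerSeries.subst chart2 θ.b ∧
    X 1 ^ (s + 1) * θ'.a =
      MvPowerSeries.subst chart2 θ.a - X 0 * MvPowerSeries.subst chart2 θ.b ∧
    ¬ (X 1 ∣ θ'.a ∧ X 1 ∣ θ'.b)

/-- Successor node: the saturated transform of `θ` at some `κ`-rational point of the exceptional line
of the blow-up of the origin. [OURS · L1 W4.5c] — NOT a statement of the manuscript. -/
def IsSucc (θ θ' : PlanarField κ) : Prop := (∃ c : κ, IsSuccChart1 c θ θ') ∨ IsSuccChart2 θ θ'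

end PlanarField

/-- **D1 `W1NPrint p` (WIDE form of record)**: over every field of characteristic `p`, from an
ISOLATED BAD node every long enough chain of successive saturated point-blow-up transforms leaves the
bad class (i.e. reaches a regular point or a reduced = non-nilpotent singularity).  Seidenberg's
reduction of singularities of planar vector fields, characteristic-`p` reading — PRINT-PENDING
acq-13204 (Brunella 2015, Thm 1) / acq-06968 (Seidenberg 1968); AI-level: discharged on tri-2's book by
`W1N-CASCADE.md` (`N = 2μ + 1`, Noether's formula only), countersign pending.  The ONE named residual of
the S1a cut (director RULING w45c-S1a-RESIDUAL, condition (1)); consumed only by `stub_localGame`.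
[OURS · L1 W4.5c] — NOT a statement of the manuscript. -/
def W1NPrint (p : ℕ) : Prop :=
  ∀ (κ : Type) [Field κ] [CharP κ p] (θ : PlanarField κ), θ.IsIsolated → θ.IsBadNode →
    ∃ N : ℕ, ∀ chain : Fin (N + 1) → PlanarField κ, chain 0 = θ →
      (∀ i : Fin N, (chain i.castSucc).IsSucc (chain i.succ)) → ∃ i, ¬ (chain i).IsBadNode

end Summit.ResolutionOfSingularities.ResolutionOfSingularities.Theorems.WildQuotientResolution.S1

end
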